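import Summits.CriticalPhenomena.SAWScalingLimit.Theorems.SAWSpinMonotoneQCIdentificationNoBranchingHexagonAux

/-!
# `NoBranching`, step S2 — the interior hexagon ledger (helper of
`stub_noBranching : NoFoldBound → NoBranching`, line `eight_fifths_primitive`, crux
`QCIdentification`, stmt-CriticalPhenomena-16772)

**What.** Let `F = Fobs Λ a` be the critical parafermionic observable of a simply connected
hexagonal domain `Λ` with boundary source `a`, under the no-fold bound (K) (`NoFoldBound`). Fix a
site `x` of `𝕋` whose six faces `v_j = HexKernel.face x j` lie in `Λ` and have non-degenerate
`∂H`-modes `S_j = modeSum F v_j ≠ 0`, so that every image triangle is non-degenerate and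
positively oriented (`SAWSpinMonotoneQCIdentificationNoBranchingCorners`). With the corner index
`k_j = cornerIdx j` of `v_j` at `x` and the corner factors `P_j`, `Q_j` of the auxiliary file
`SAWSpinMonotoneQCIdentificationNoBranchingHexagonAux` (both in the open right half-plane), this
file proves the EXACT real bookkeeping

* `cornerAngle F v_j k_j = π/3 + arg Q_j - arg P_j` (`cornerAngle_face_eq`: the corner dart ratio
  is `ω P_j/Q_j`, arguments add modulo `2π`, and the identity is pinned to the reals because the
  corner angle lies in `(0, π)` and `|arg P_j|, |arg Q_j| < π/2`);
* `arg (S_{j+1}/S_j) = arg Q_j - arg P_{j+1}` (`arg_modeSum_succ_div`: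
  `S_{j+1}/S_j = Q_j/P_{j+1}` is a quotient of two right half-plane numbers);

and deduces, summing over `j : Fin 6` and re-indexing,

* **(a) the hexagon ledger** `Σ_j cornerAngle F v_j k_j = 2π + Σ_j arg (S_{j+1}/S_j)`
  (`hexagon_corner_sum`, registered `s2_hexagon_corner_sum`) — the right-hand sum is verbatim the
  typed sum of `NoBranching`;
* **(b) integrality**: the typed sum is `2π m`, `m ∈ ℤ` (the six ratios multiply to `1`,
  `typedSum_eq_two_pi_mul`), and the corner sum is positive, so
  `Σ_j cornerAngle F v_j k_j = 2π d` with `d ∈ ℕ`, `d ≥ 1` (`hexagon_corner_sum_int`,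
  registered `s2_hexagon_corner_sum_int`) and the typed sum is `2π n`, `n ∈ ℕ`
  (`typedSum_nonneg_int`,
  registered `s2_typedSum_nonneg_int`).

**Why.** `d` is the local degree at `H(x)` of the piecewise-affine developing map `H`; the global
Gauss–Bonnet count (steps S3–S7 of the stub report `STUB-REPORT-noBranching.md` §2: corner
angles sum to `π` on every face, boundary excess `≥ 0` by the boundary step law) forces `d = 1`
at every interior hexagon, i.e. the typed sum vanishes: `NoBranching`.

Sources: H. Duminil-Copin, S. Smirnov, *The connective constant of the honeycomb lattice equals
`√(2+√2)`*, Ann. of Math. 175 (2012) 1653–1665 (arXiv:1007.0575), Lemma 1 (through the affine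
dictionary); the angle bookkeeping is the elementary degree count for piecewise linear maps
(folklore).
-/

noncomputable section

open Complex
open scoped ComplexConjugate
open Literature.Probability.LatticeModels Literature.Probability.RandomPlanarGeometry.SAW
open Literature.Barriers.CriticalPhenomena
open Summit.CriticalPhenomena.SAWScalingLimit.Theses.SAWDevelopingMap

namespace Summit.CriticalPhenomena.SAWScalingLimit.Cruxes.QCIdentification.EightFifthsPrimitive

namespace NB

open Dev

variable {Λ : Finset HexVertex} {a : Sym2 HexVertex} {x : Site 2}

/-! ### Pinning angle identities to the reals -/

/-- Two reals with the same angle at distance `< 2π` are equal. -/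
theorem eq_of_coe_angle_eq {p q : ℝ} (h : (p : Real.Angle) = q) (hlo : -(2 * Real.pi) < p - q)
    (hhi : p - q < 2 * Real.pi) : p = q := by
  obtain ⟨k, hk⟩ := Real.Angle.angle_eq_iff_two_pi_dvd_sub.1 h
  have hπ := Real.pi_pos
  rw [hk] at hlo hhi
  have h1 : (-1 : ℝ) < k := by
    by_contra hc
    have : 2 * Real.pi * k ≤ 2 * Real.pi * (-1) :=
      mul_le_mul_of_nonneg_left (not_lt.1 hc) (by positivity)
    linarith
  have h2 : (k : ℝ) < 1 := by
    by_contra hc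
    have : 2 * Real.pi * 1 ≤ 2 * Real.pi * k :=
      mul_le_mul_of_nonneg_left (not_lt.1 hc) (by positivity)
    linarith
  have hk0 : k = 0 := by
    have h1' : (-1 : ℤ) < k := by exact_mod_cast h1
    have h2' : k < (1 : ℤ) := by exact_mod_cast h2
    omega
  rw [hk0, Int.cast_zero, mul_zero, sub_eq_zero] at hk
  exact hk

/-- `arg (z / w) = arg z - arg w` for `z`, `w` in the open right half-plane. -/
theorem arg_div_of_re_pos {z w : ℂ} (hz : 0 < z.re) (hw : 0 < w.re) :
    arg (z / w) = arg z - arg w := by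
  have hz0 := Complex.ne_zero_of_re_pos hz
  have hw0 := Complex.ne_zero_of_re_pos hw
  have hza := abs_lt.1 (Complex.abs_arg_lt_pi_div_two_iff.2 (Or.inl hz))
  have hwa := abs_lt.1 (Complex.abs_arg_lt_pi_div_two_iff.2 (Or.inl hw))
  have hπ := Real.pi_pos
  refine eq_of_coe_angle_eq
    (by rw [Complex.arg_div_coe_angle hz0 hw0, Real.Angle.coe_sub]) ?_ ?_
  · linarith [Complex.neg_pi_lt_arg (z / w)]
  · linarith [Complex.arg_le_pi (z / w)]

/-- `arg ω = 2π/3` as an angle (`ω = e^{2πi/3}`). -/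
theorem arg_omg_coe : (arg omg : Real.Angle) = ((2 * Real.pi / 3 : ℝ) : Real.Angle) := by
  rw [omg]
  have : (2 * (Real.pi : ℂ) * I / 3) = ((2 * Real.pi / 3 : ℝ) : ℂ) * I := by push_cast; ring
  rw [this, Complex.arg_exp_mul_I, Real.Angle.coe_toIocMod]

/-! ### The two exact identities at a corner -/

/-- **The turning angle at the corner, exactly**:
`arg (dart_{k_j+1}/dart_{k_j}) = 2π/3 + arg P_j - arg Q_j`. -/
theorem arg_dart_corner_div (hK : NoFoldBound) (hΛ : hexDomainSimplyConnected Λ)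
    (ha : a ∈ hexDomainBoundary Λ) (j : Fin 6) (hv : HexKernel.face x j ∈ Λ)
    (hS : modeSum (Fobs Λ a) (HexKernel.face x j) ≠ 0) :
    arg (dart (Fobs Λ a) (HexKernel.face x j) (cornerIdx j + 1) /
        dart (Fobs Λ a) (HexKernel.face x j) (cornerIdx j)) =
      2 * Real.pi / 3 + arg (pfac (Fobs Λ a) x j) - arg (qfac (Fobs Λ a) x j) := by
  have hPr := pfac_re_pos hK hΛ ha hv hS
  have hQr := qfac_re_pos hK hΛ ha hv hS
  have hP := Complex.ne_zero_of_re_pos hPr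
  have hQ := Complex.ne_zero_of_re_pos hQr
  have hPa := abs_lt.1 (Complex.abs_arg_lt_pi_div_two_iff.2 (Or.inl hPr))
  have hQa := abs_lt.1 (Complex.abs_arg_lt_pi_div_two_iff.2 (Or.inl hQr))
  have hlo := arg_dart_div_pos hK hΛ ha hv hS (cornerIdx j)
  have hhi := arg_dart_div_lt_pi hK hΛ ha hv hS (cornerIdx j)
  have hπ := Real.pi_pos
  have hω : omg ≠ 0 := by
    rw [omg]
    exact Complex.exp_ne_zero _
  refine eq_of_coe_angle_eq ?_ (by linarith) (by linarith)
  rw [dart_corner_div hK hΛ ha j hv hS,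
    Complex.arg_mul_coe_angle hω (div_ne_zero hP hQ), arg_omg_coe,
    Complex.arg_div_coe_angle hP hQ, Real.Angle.coe_sub, Real.Angle.coe_add]
  abel

/-- **The corner angle, exactly**: `cornerAngle_j = π/3 + arg Q_j - arg P_j`. -/
theorem cornerAngle_face_eq (hK : NoFoldBound) (hΛ : hexDomainSimplyConnected Λ)
    (ha : a ∈ hexDomainBoundary Λ) (j : Fin 6) (hv : HexKernel.face x j ∈ Λ)
    (hS : modeSum (Fobs Λ a) (HexKernel.face x j) ≠ 0) :
    cornerAngle (Fobs Λ a) (HexKernel.face x j) (cornerIdx j) =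
      Real.pi / 3 + arg (qfac (Fobs Λ a) x j) - arg (pfac (Fobs Λ a) x j) := by
  rw [cornerAngle, arg_dart_corner_div hK hΛ ha j hv hS]
  ring

/-- **The typed increment, exactly**: `arg (S_{j+1}/S_j) = arg Q_j - arg P_{j+1}`. -/
theorem arg_modeSum_succ_div (hK : NoFoldBound) (hΛ : hexDomainSimplyConnected Λ)
    (ha : a ∈ hexDomainBoundary Λ) (j : Fin 6) (hv : HexKernel.face x j ∈ Λ)
    (hv' : HexKernel.face x (j + 1) ∈ Λ) (hS : modeSum (Fobs Λ a) (HexKernel.face x j) ≠ 0)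
    (hS' : modeSum (Fobs Λ a) (HexKernel.face x (j + 1)) ≠ 0) :
    arg (modeSum (Fobs Λ a) (HexKernel.face x (j + 1)) /
        modeSum (Fobs Λ a) (HexKernel.face x j)) =
      arg (qfac (Fobs Λ a) x j) - arg (pfac (Fobs Λ a) x (j + 1)) := by
  rw [modeSum_succ_div hK hΛ ha j hv hv' hS hS',
    arg_div_of_re_pos (qfac_re_pos hK hΛ ha hv hS) (pfac_re_pos hK hΛ ha hv' hS')]

/-! ### The hexagon ledger -/

/-- **(a) The interior hexagon ledger.** At a site whose six faces lie in `Λ` with non-degenerate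
`∂H`-modes, the six corner angles at the site sum to `2π` plus the typed `NoBranching` sum. -/
theorem hexagon_corner_sum (hK : NoFoldBound) (hΛ : hexDomainSimplyConnected Λ)
    (ha : a ∈ hexDomainBoundary Λ) (x : Site 2) (hx : ∀ j : Fin 6, HexKernel.face x j ∈ Λ)
    (hS : ∀ j : Fin 6, modeSum (Fobs Λ a) (HexKernel.face x j) ≠ 0) :
    ∑ j : Fin 6, cornerAngle (Fobs Λ a) (HexKernel.face x j) (cornerIdx j) =
      2 * Real.pi + ∑ j : Fin 6, arg (modeSum (Fobs Λ a) (HexKernel.face x (j + 1)) /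
        modeSum (Fobs Λ a) (HexKernel.face x j)) := by
  have hc : ∀ j : Fin 6, cornerAngle (Fobs Λ a) (HexKernel.face x j) (cornerIdx j) =
      Real.pi / 3 + arg (qfac (Fobs Λ a) x j) - arg (pfac (Fobs Λ a) x j) :=
    fun j => cornerAngle_face_eq hK hΛ ha j (hx j) (hS j)
  have ht : ∀ j : Fin 6, arg (modeSum (Fobs Λ a) (HexKernel.face x (j + 1)) /
      modeSum (Fobs Λ a) (HexKernel.face x j)) =
        arg (qfac (Fobs Λ a) x j) - arg (pfac (Fobs Λ a) x (j + 1)) :=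
    fun j => arg_modeSum_succ_div hK hΛ ha j (hx j) (hx (j + 1)) (hS j) (hS (j + 1))
  have hre : ∑ j : Fin 6, arg (pfac (Fobs Λ a) x (j + 1)) =
      ∑ j : Fin 6, arg (pfac (Fobs Λ a) x j) :=
    Fintype.sum_equiv (Equiv.addRight 1) _ _ (fun _ => rfl)
  simp only [hc, ht, Finset.sum_sub_distrib, Finset.sum_add_distrib, Finset.sum_const,
    Finset.card_univ, Fintype.card_fin, nsmul_eq_mul, hre]
  push_cast
  ring

/-- The typed sum is an integer multiple of `2π` (the six ratios multiply to `1`; arguments add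
modulo `2π`). -/
theorem typedSum_eq_two_pi_mul {S : Fin 6 → ℂ} (hS : ∀ j, S j ≠ 0) :
    ∃ m : ℤ, ∑ j : Fin 6, arg (S (j + 1) / S j) = 2 * Real.pi * m := by
  have h : ((∑ j : Fin 6, arg (S (j + 1) / S j) : ℝ) : Real.Angle) =
      ((0 : ℝ) : Real.Angle) := by
    have h1 := map_sum Real.Angle.coeHom (fun j : Fin 6 => arg (S (j + 1) / S j)) Finset.univ
    simp only [Real.Angle.coe_coeHom] at h1
    rw [h1]
    simp only [Complex.arg_div_coe_angle (hS _) (hS _), Finset.sum_sub_distrib]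
    have h2 : ∑ j : Fin 6, (arg (S (j + 1)) : Real.Angle) =
        ∑ j : Fin 6, (arg (S j) : Real.Angle) :=
      Fintype.sum_equiv (Equiv.addRight 1) _ _ (fun _ => rfl)
    rw [h2, sub_self, Real.Angle.coe_zero]
  obtain ⟨m, hm⟩ := Real.Angle.angle_eq_iff_two_pi_dvd_sub.1 h
  exact ⟨m, by rw [sub_zero] at hm; exact hm⟩

/-- **(b) The corner sum is `2π d` with `d ≥ 1`** (it is positive and, by (a) and the integrality
of the typed sum, an integer multiple of `2π`). -/
theorem hexagon_corner_sum_int (hK : NoFoldBound) (hΛ : hexDomainSimplyConnected Λ)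
    (ha : a ∈ hexDomainBoundary Λ) (x : Site 2) (hx : ∀ j : Fin 6, HexKernel.face x j ∈ Λ)
    (hS : ∀ j : Fin 6, modeSum (Fobs Λ a) (HexKernel.face x j) ≠ 0) :
    ∃ d : ℕ, 1 ≤ d ∧
      ∑ j : Fin 6, cornerAngle (Fobs Λ a) (HexKernel.face x j) (cornerIdx j) =
        2 * Real.pi * d := by
  obtain ⟨m, hm⟩ :=
    typedSum_eq_two_pi_mul (S := fun j => modeSum (Fobs Λ a) (HexKernel.face x j)) hS
  have hsum := hexagon_corner_sum hK hΛ ha x hx hS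
  rw [hm] at hsum
  have hpos : 0 < ∑ j : Fin 6, cornerAngle (Fobs Λ a) (HexKernel.face x j) (cornerIdx j) :=
    Finset.sum_pos (fun j _ => cornerAngle_pos hK hΛ ha (hx j) (hS j) _) Finset.univ_nonempty
  have hπ := Real.pi_pos
  have hm1 : (-1 : ℝ) < m := by
    by_contra hc
    have : 2 * Real.pi * m ≤ 2 * Real.pi * (-1) :=
      mul_le_mul_of_nonneg_left (not_lt.1 hc) (by positivity)
    linarith
  have hm0 : (0 : ℤ) ≤ m := by
    have : (-1 : ℤ) < m := by exact_mod_cast hm1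
    omega
  obtain ⟨d, hd⟩ := Int.eq_ofNat_of_zero_le hm0
  refine ⟨d + 1, by omega, ?_⟩
  rw [hsum, hd]
  push_cast
  ring

/-- **Corollary: the typed sum is a non-negative multiple of `2π`** (`n = d - 1`). -/
theorem typedSum_nonneg_int (hK : NoFoldBound) (hΛ : hexDomainSimplyConnected Λ)
    (ha : a ∈ hexDomainBoundary Λ) (x : Site 2) (hx : ∀ j : Fin 6, HexKernel.face x j ∈ Λ)
    (hS : ∀ j : Fin 6, modeSum (Fobs Λ a) (HexKernel.face x j) ≠ 0) :
    ∃ n : ℕ, ∑ j : Fin 6, arg (modeSum (Fobs Λ a) (HexKernel.face x (j + 1)) /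
        modeSum (Fobs Λ a) (HexKernel.face x j)) = 2 * Real.pi * n := by
  obtain ⟨d, hd1, hd⟩ := hexagon_corner_sum_int hK hΛ ha x hx hS
  have hsum := hexagon_corner_sum hK hΛ ha x hx hS
  refine ⟨d - 1, ?_⟩
  rw [Nat.cast_sub hd1]
  push_cast
  linarith

/-! ### Registered entry points (∀-telescopes) -/

/-- **S2 (a), registered form.** The six corner angles at an interior site with non-degenerate
faces sum to `2π` plus the typed `NoBranching` sum, exactly. -/
theorem s2_hexagon_corner_sum : NoFoldBound → ∀ {Λ : Finset HexVertex}, hexDomainSimplyConnected Λ → ∀ {a : Sym2 HexVertex}, a ∈ hexDomainBoundary Λ → ∀ (x : Site 2), (∀ j : Fin 6, HexKernel.face x j ∈ Λ) → (∀ j : Fin 6, modeSum (Fobs Λ a) (HexKernel.face x j) ≠ 0) → ∑ j : Fin 6, cornerAngle (Fobs Λ a) (HexKernel.face x j) (cornerIdx j) = 2 * Real.pi + ∑ j : Fin 6, Complex.arg (modeSum (Fobs Λ a) (HexKernel.face x (j + 1)) / modeSum (Fobs Λ a) (HexKernel.face x j)) :=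
  fun hK _ hΛ _ ha x hx hS => hexagon_corner_sum hK hΛ ha x hx hS

/-- **S2 (b), registered form.** The six corner angles at an interior site with non-degenerate
faces sum to `2π d` for a natural number `d ≥ 1` (the local degree of the developing map). -/
theorem s2_hexagon_corner_sum_int : NoFoldBound → ∀ {Λ : Finset HexVertex}, hexDomainSimplyConnected Λ → ∀ {a : Sym2 HexVertex}, a ∈ hexDomainBoundary Λ → ∀ (x : Site 2), (∀ j : Fin 6, HexKernel.face x j ∈ Λ) → (∀ j : Fin 6, modeSum (Fobs Λ a) (HexKernel.face x j) ≠ 0) → ∃ d : ℕ, 1 ≤ d ∧ ∑ j : Fin 6, cornerAngle (Fobs Λ a) (HexKernel.face x j) (cornerIdx j) = 2 * Real.pi * d :=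
  fun hK _ hΛ _ ha x hx hS => hexagon_corner_sum_int hK hΛ ha x hx hS

/-- **S2 corollary, registered form.** The typed `NoBranching` sum at an interior site with
non-degenerate faces is `2π n` for a natural number `n` (`= d - 1`). -/
theorem s2_typedSum_nonneg_int : NoFoldBound → ∀ {Λ : Finset HexVertex}, hexDomainSimplyConnected Λ → ∀ {a : Sym2 HexVertex}, a ∈ hexDomainBoundary Λ → ∀ (x : Site 2), (∀ j : Fin 6, HexKernel.face x j ∈ Λ) → (∀ j : Fin 6, modeSum (Fobs Λ a) (HexKernel.face x j) ≠ 0) → ∃ n : ℕ, ∑ j : Fin 6, Complex.arg (modeSum (Fobs Λ a) (HexKernel.face x (j + 1)) / modeSum (Fobs Λ a) (HexKernel.face x j)) = 2 * Real.pi * n :=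
  fun hK _ hΛ _ ha x hx hS => typedSum_nonneg_int hK hΛ ha x hx hS

end NB

end Summit.CriticalPhenomena.SAWScalingLimit.Cruxes.QCIdentification.EightFifthsPrimitive

end
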